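import Literature.Probability.FitznerVanDerHofstad2017.NobleElementsClosedForms
import HarnessLib

/-!
# [FvdH17] §5.1 "Elements of the bounds": letter forms of the rows `a = 1` and `a = 2` of the matrices
`A`, `A^*`, `A^ι`, `A^{ι,*}`, `Ā^ι`, `Ā^{ι,*}` (tranche 2 of `NobleElementsClosedForms`)

Source: R. Fitzner, R. van der Hofstad, *Mean-field behavior for nearest-neighbor percolation in `d > 10`*,
Electron. J. Probab. **22** (2017) no. 43 [FvdH17]; extended version arXiv:1506.07977v2, §5.1 "Elements of the
bounds" (p. 49) and App. B, Tables "definition of `A^{a,b}(0,v,x,y)`" (p. 74), "`A^{ι,a,b}(0,v,x,y)`" (p. 75),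
"`Ā^{ι,a,b}(0,v,x,y)`" (p. 78).

`NobleElementsClosedForms` summed out the Kronecker constraints of the rows `a = 0` ("`⇒ v = 0`").  This module
does the same for the remaining rows of the six open matrices of §5.1, for every letter table `L : Letters d`:
* rows `a = 1` carry the factor `2dD(v) = 𝟙{v is a unit vector}` (`twoDD`): the supremum over `v ∈ ℤ^d` becomes a
  finite supremum over the `2d` directions `v = e_{ι'}` (`iSup_eq_iSup_stepVec`), e.g.
  `(A)_{1,0} = sup_{ι'} Σ_x B_{1,1}(x, e_{ι'})`, `(Ā^ι)_{1,0} = sup_{ι'} Σ_x Σ_κ (1−δ_{x,0}) T_{1̲,1,0}(e_κ,x,e_{ι'})`,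
  `(Ā^ι)_{1,1} = sup_{ι'} sup_y Σ_x Σ_κ p⁻¹ S_{1̲,0,1̲,0}(e_κ,x,x+y,e_{ι'})`;
* rows `a = 2` carry no constraint on `v`: the supremum over `v` survives and only the diagonal constraint
  `δ_{x,y}` of the column `b = 0` is summed out, e.g. `(A)_{2,0} = sup_v Σ_x B_{1,0}(x,v)`,
  `(Ā^ι)_{2,0} = sup_v Σ_x Σ_κ T_{1̲,1,0}(e_κ,x,v)`; and in the entry `(Ā^ι)_{2,2} = sup_{v,y} Σ_{κ,x} p τ(x−e_κ)
  τ(v−x−y)` the two suprema merge into one over `w = v − y` (`iSup_iSup_sub_eq`).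
Equalities in `ℝ≥0∞`; no inequality, no cell, no numeral; nothing landed is modified; no cited hypothesis.
-/

noncomputable section

namespace Literature.Probability.FitznerVanDerHofstad2017.NobleBlocks

open Literature.Probability.LatticeModels Literature.Probability.Percolation
open Literature.Probability.FitznerVanDerHofstad2017.BlockSummation
open scoped BigOperators ENNReal Matrix

local notation "𝐞" => Literature.Probability.Percolation.stepVec

variable {d : ℕ}

/-! ## G. The unit-vector supremum and the merged supremum -/

/-- `2dD(v) = 0` off the unit vectors. [cite: FitznerVanDerHofstad2017, §5.1 "Elements of the bounds", `D(v)` (arXiv:1506.07977v2 p. 49)] -/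
theorem twoDD_of_not_exists {v : Site d} (h : ¬ ∃ ι : Fin d × Bool, v = 𝐞 ι) : twoDD v = 0 := by
  simp [twoDD, h]

/-- A supremum over `ℤ^d` of a function vanishing off the unit vectors is the finite supremum over the `2d`
directions. [folklore] -/
theorem iSup_eq_iSup_stepVec (F : Site d → ℝ≥0∞) (hF : ∀ v, (¬ ∃ ι : Fin d × Bool, v = 𝐞 ι) → F v = 0) :
    ⨆ v, F v = ⨆ ι : Fin d × Bool, F (𝐞 ι) := by
  refine le_antisymm (iSup_le fun v => ?_) (iSup_le fun ι => le_iSup F _)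
  by_cases h : ∃ ι : Fin d × Bool, v = 𝐞 ι
  · obtain ⟨ι, rfl⟩ := h
    exact le_iSup (fun ι : Fin d × Bool => F (𝐞 ι)) ι
  · simp [hF v h]

/-- `sup_{v,y} H(v − y) = sup_w H(w)`. [folklore] -/
theorem iSup_iSup_sub_eq (H : Site d → ℝ≥0∞) : ⨆ v, ⨆ y, H (v - y) = ⨆ w, H w :=
  le_antisymm (iSup₂_le fun v y => le_iSup H (v - y))
    (iSup_le fun w => le_iSup₂_of_le (f := fun v y => H (v - y)) w 0 (by simp))

section Rows

variable (L : Letters d)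

/-! ## Rows `a = 1` of `A`, `A^*` -/

/-- `(A)_{1,0} = sup_{ι'} Σ_x B_{1,1}(x, e_{ι'})` (row `a = 1, b = 0`: `δ_{x,y} 2dD(v) B_{1,1}(x,v)`).
[cite: FitznerVanDerHofstad2017, App. B Table "definition of A^{a,b}(0,v,x,y)", row (1,0) (arXiv:1506.07977v2 p. 74); §5.1 (p. 49)] -/
theorem matA_one_zero : matA L 1 0 = ⨆ ι' : Fin d × Bool, ∑' x, L.B (.ge 1) (.ge 1) x (𝐞 ι') := by
  have h : ∀ v x y, blockA L 1 0 0 v x y = kd x y * twoDD v * L.B (.ge 1) (.ge 1) x v := fun v x y => by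
    rw [blockA, ofBase_zero]; rfl
  rw [matA, matB₀_apply, normB,
    iSup_eq_iSup_stepVec (fun v => ∑' x, ∑' y, blockA L 1 0 0 v x y) fun v hv => by
      simp [h, twoDD_of_not_exists hv]]
  simp only [h, twoDD_stepVec, mul_one, ENNReal.tsum_mul_right, tsum_kd, one_mul]

/-- `(A)_{1,1} = sup_{ι'} Σ_{x,y} T_{1,1̲,0}(x,y,e_{ι'})`.
[cite: FitznerVanDerHofstad2017, App. B Table "definition of A^{a,b}(0,v,x,y)", row (1,1) (arXiv:1506.07977v2 p. 74); §5.1 (p. 49)] -/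
theorem matA_one_one :
    matA L 1 1 = ⨆ ι' : Fin d × Bool, ∑' x, ∑' y, L.T (.ge 1) (.eq 1) (.ge 0) x y (𝐞 ι') := by
  have h : ∀ v x y, blockA L 1 1 0 v x y = twoDD v * L.T (.ge 1) (.eq 1) (.ge 0) x y v := fun v x y => by
    rw [blockA, ofBase_zero]; rfl
  rw [matA, matB₀_apply, normB,
    iSup_eq_iSup_stepVec (fun v => ∑' x, ∑' y, blockA L 1 1 0 v x y) fun v hv => by
      simp [h, twoDD_of_not_exists hv]]
  simp only [h, twoDD_stepVec, one_mul]

/-- `(A)_{1,2} = sup_{ι'} Σ_{x,y} T_{1,2,0}(x,y,e_{ι'})`.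
[cite: FitznerVanDerHofstad2017, App. B Table "definition of A^{a,b}(0,v,x,y)", row (1,2) (arXiv:1506.07977v2 p. 74); §5.1 (p. 49)] -/
theorem matA_one_two :
    matA L 1 2 = ⨆ ι' : Fin d × Bool, ∑' x, ∑' y, L.T (.ge 1) (.ge 2) (.ge 0) x y (𝐞 ι') := by
  have h : ∀ v x y, blockA L 1 2 0 v x y = twoDD v * L.T (.ge 1) (.ge 2) (.ge 0) x y v := fun v x y => by
    rw [blockA, ofBase_zero]; rfl
  rw [matA, matB₀_apply, normB,
    iSup_eq_iSup_stepVec (fun v => ∑' x, ∑' y, blockA L 1 2 0 v x y) fun v hv => by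
      simp [h, twoDD_of_not_exists hv]]
  simp only [h, twoDD_stepVec, one_mul]

/-- `(A^*)_{1,0} = (A)_{1,0}`'s form (row `b = 0` repulsive). [cite: FitznerVanDerHofstad2017, §5.1 Table "A^{a,b,*}" (arXiv:1506.07977v2 p. 47); App. B (p. 74)] -/
theorem matAst_one_zero : matAst L 1 0 = ⨆ ι' : Fin d × Bool, ∑' x, L.B (.ge 1) (.ge 1) x (𝐞 ι') := by
  have h : ∀ v x y, blockAst L 1 0 0 v x y = kd x y * twoDD v * L.B (.ge 1) (.ge 1) x v := fun v x y => by
    rw [blockAst, ofBase_zero]; rfl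
  rw [matAst, matB₀_apply, normB,
    iSup_eq_iSup_stepVec (fun v => ∑' x, ∑' y, blockAst L 1 0 0 v x y) fun v hv => by
      simp [h, twoDD_of_not_exists hv]]
  simp only [h, twoDD_stepVec, mul_one, ENNReal.tsum_mul_right, tsum_kd, one_mul]

/-- `(A^*)_{1,1} = sup_{ι'} Σ_{x,y} T^*_{1,1̲,0}(x,y,e_{ι'})`. [cite: FitznerVanDerHofstad2017, §5.1 Table "A^{a,b,*}" (arXiv:1506.07977v2 p. 47); App. B (p. 74)] -/
theorem matAst_one_one :
    matAst L 1 1 = ⨆ ι' : Fin d × Bool, ∑' x, ∑' y, L.Tst (.ge 1) (.eq 1) (.ge 0) x y (𝐞 ι') := by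
  have h : ∀ v x y, blockAst L 1 1 0 v x y = twoDD v * L.Tst (.ge 1) (.eq 1) (.ge 0) x y v := fun v x y => by
    rw [blockAst, ofBase_zero]; rfl
  rw [matAst, matB₀_apply, normB,
    iSup_eq_iSup_stepVec (fun v => ∑' x, ∑' y, blockAst L 1 1 0 v x y) fun v hv => by
      simp [h, twoDD_of_not_exists hv]]
  simp only [h, twoDD_stepVec, one_mul]

/-- `(A^*)_{1,2} = sup_{ι'} Σ_{x,y} T^*_{1,2,0}(x,y,e_{ι'})`. [cite: FitznerVanDerHofstad2017, §5.1 Table "A^{a,b,*}" (arXiv:1506.07977v2 p. 47); App. B (p. 74)] -/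
theorem matAst_one_two :
    matAst L 1 2 = ⨆ ι' : Fin d × Bool, ∑' x, ∑' y, L.Tst (.ge 1) (.ge 2) (.ge 0) x y (𝐞 ι') := by
  have h : ∀ v x y, blockAst L 1 2 0 v x y = twoDD v * L.Tst (.ge 1) (.ge 2) (.ge 0) x y v := fun v x y => by
    rw [blockAst, ofBase_zero]; rfl
  rw [matAst, matB₀_apply, normB,
    iSup_eq_iSup_stepVec (fun v => ∑' x, ∑' y, blockAst L 1 2 0 v x y) fun v hv => by
      simp [h, twoDD_of_not_exists hv]]
  simp only [h, twoDD_stepVec, one_mul]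

/-! ## Rows `a = 2` of `A`, `A^*` -/

/-- `(A)_{2,0} = sup_v Σ_x B_{1,0}(x,v)` (row `a ≥ 2, b = 0`: `δ_{x,y} B_{1,0}(x,v)`; the supremum over `v` survives).
[cite: FitznerVanDerHofstad2017, App. B Table "definition of A^{a,b}(0,v,x,y)", row (2,0) (arXiv:1506.07977v2 p. 74); §5.1 (p. 49)] -/
theorem matA_two_zero : matA L 2 0 = ⨆ v, ∑' x, L.B (.ge 1) (.ge 0) x v := by
  have h : ∀ v x y, blockA L 2 0 0 v x y = kd x y * L.B (.ge 1) (.ge 0) x v := fun v x y => by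
    rw [blockA, ofBase_zero]; rfl
  rw [matA, matB₀_apply, normB]
  simp only [h, ENNReal.tsum_mul_right, tsum_kd, one_mul]

/-- `(A)_{2,1} = sup_v Σ_{x,y} T_{1,1̲,0}(x,y,v)`. [cite: FitznerVanDerHofstad2017, App. B Table "definition of A^{a,b}(0,v,x,y)", row (2,1) (arXiv:1506.07977v2 p. 74); §5.1 (p. 49)] -/
theorem matA_two_one : matA L 2 1 = ⨆ v, ∑' x, ∑' y, L.T (.ge 1) (.eq 1) (.ge 0) x y v := by
  have h : ∀ v x y, blockA L 2 1 0 v x y = L.T (.ge 1) (.eq 1) (.ge 0) x y v := fun v x y => by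
    rw [blockA, ofBase_zero]; rfl
  rw [matA, matB₀_apply, normB]
  simp only [h]

/-- `(A)_{2,2} = sup_v Σ_{x,y} T_{1,2,0}(x,y,v)`. [cite: FitznerVanDerHofstad2017, App. B Table "definition of A^{a,b}(0,v,x,y)", row (2,2) (arXiv:1506.07977v2 p. 74); §5.1 (p. 49)] -/
theorem matA_two_two : matA L 2 2 = ⨆ v, ∑' x, ∑' y, L.T (.ge 1) (.ge 2) (.ge 0) x y v := by
  have h : ∀ v x y, blockA L 2 2 0 v x y = L.T (.ge 1) (.ge 2) (.ge 0) x y v := fun v x y => by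
    rw [blockA, ofBase_zero]; rfl
  rw [matA, matB₀_apply, normB]
  simp only [h]

/-- `(A^*)_{2,0} = sup_v Σ_x B_{1,0}(x,v)`. [cite: FitznerVanDerHofstad2017, §5.1 Table "A^{a,b,*}" (arXiv:1506.07977v2 p. 47); App. B (p. 74)] -/
theorem matAst_two_zero : matAst L 2 0 = ⨆ v, ∑' x, L.B (.ge 1) (.ge 0) x v := by
  have h : ∀ v x y, blockAst L 2 0 0 v x y = kd x y * L.B (.ge 1) (.ge 0) x v := fun v x y => by
    rw [blockAst, ofBase_zero]; rfl
  rw [matAst, matB₀_apply, normB]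
  simp only [h, ENNReal.tsum_mul_right, tsum_kd, one_mul]

/-- `(A^*)_{2,1} = sup_v Σ_{x,y} T^*_{1,1̲,0}(x,y,v)`. [cite: FitznerVanDerHofstad2017, §5.1 Table "A^{a,b,*}" (arXiv:1506.07977v2 p. 47); App. B (p. 74)] -/
theorem matAst_two_one : matAst L 2 1 = ⨆ v, ∑' x, ∑' y, L.Tst (.ge 1) (.eq 1) (.ge 0) x y v := by
  have h : ∀ v x y, blockAst L 2 1 0 v x y = L.Tst (.ge 1) (.eq 1) (.ge 0) x y v := fun v x y => by
    rw [blockAst, ofBase_zero]; rfl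
  rw [matAst, matB₀_apply, normB]
  simp only [h]

/-- `(A^*)_{2,2} = sup_v Σ_{x,y} T^*_{1,2,0}(x,y,v)`. [cite: FitznerVanDerHofstad2017, §5.1 Table "A^{a,b,*}" (arXiv:1506.07977v2 p. 47); App. B (p. 74)] -/
theorem matAst_two_two : matAst L 2 2 = ⨆ v, ∑' x, ∑' y, L.Tst (.ge 1) (.ge 2) (.ge 0) x y v := by
  have h : ∀ v x y, blockAst L 2 2 0 v x y = L.Tst (.ge 1) (.ge 2) (.ge 0) x y v := fun v x y => by
    rw [blockAst, ofBase_zero]; rfl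
  rw [matAst, matB₀_apply, normB]
  simp only [h]

/-! ## Rows `a = 1`, `a = 2` of `A^ι`, `A^{ι,*}` -/

/-- `(A^ι)_{1,0} = sup_{ι'} Σ_x Σ_κ (1−δ_{x,0}) T_{1̲,1,0}(e_κ,x,e_{ι'})` (row `a = 1, b = 0 (⇒ x = y)`:
`δ_{x,y}(1−δ_{x,0}) 2dD(v) T_{1̲,1,0}(e,x,v)`). [cite: FitznerVanDerHofstad2017, App. B Table "definition of A^{ι,a,b}(0,v,x,y)", row (1,0) (arXiv:1506.07977v2 p. 75); §5.1 (p. 49)] -/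
theorem matAiota_one_zero : matAiota L 1 0 =
    ⨆ ι' : Fin d × Bool, ∑' x, ∑ κ : Fin d × Bool, kdc x 0 * L.T (.eq 1) (.ge 1) (.ge 0) (𝐞 κ) x (𝐞 ι') := by
  have h : ∀ κ v x y, blockAiota L κ 1 0 0 v x y =
      kd x y * kdc x 0 * twoDD v * L.T (.eq 1) (.ge 1) (.ge 0) (𝐞 κ) x v := fun κ v x y => by
    rw [blockAiota, ofBase_zero]; rfl
  rw [matAiota, matB_apply,
    iSup_eq_iSup_stepVec (fun v => ∑' x, ∑' y, ∑ κ, blockAiota L κ 1 0 0 v x y) fun v hv => by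
      simp [h, twoDD_of_not_exists hv]]
  refine iSup_congr fun ι' => tsum_congr fun x => ?_
  rw [tsum_eq_single x fun y hy => by simp [h, kd_of_ne (Ne.symm hy)]]
  simp [h, twoDD_stepVec]

/-- `(A^ι)_{1,1} = sup_{ι'} Σ_{x,y} Σ_κ S_{1̲,0,1̲,0}(e_κ,x,y,e_{ι'})`. [cite: FitznerVanDerHofstad2017, App. B Table "definition of A^{ι,a,b}(0,v,x,y)", row (1,1) (arXiv:1506.07977v2 p. 75); §5.1 (p. 49)] -/
theorem matAiota_one_one : matAiota L 1 1 =
    ⨆ ι' : Fin d × Bool, ∑' x, ∑' y, ∑ κ : Fin d × Bool, L.S (.eq 1) (.ge 0) (.eq 1) (.ge 0) (𝐞 κ) x y (𝐞 ι') := by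
  have h : ∀ κ v x y, blockAiota L κ 1 1 0 v x y = twoDD v * L.S (.eq 1) (.ge 0) (.eq 1) (.ge 0) (𝐞 κ) x y v :=
    fun κ v x y => by rw [blockAiota, ofBase_zero]; rfl
  rw [matAiota, matB_apply,
    iSup_eq_iSup_stepVec (fun v => ∑' x, ∑' y, ∑ κ, blockAiota L κ 1 1 0 v x y) fun v hv => by
      simp [h, twoDD_of_not_exists hv]]
  simp only [h, twoDD_stepVec, one_mul]

/-- `(A^ι)_{1,2} = sup_{ι'} Σ_{x,y} Σ_κ S_{1̲,0,2,0}(e_κ,x,y,e_{ι'})`. [cite: FitznerVanDerHofstad2017, App. B Table "definition of A^{ι,a,b}(0,v,x,y)", row (1,2) (arXiv:1506.07977v2 p. 75); §5.1 (p. 49)] -/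
theorem matAiota_one_two : matAiota L 1 2 =
    ⨆ ι' : Fin d × Bool, ∑' x, ∑' y, ∑ κ : Fin d × Bool, L.S (.eq 1) (.ge 0) (.ge 2) (.ge 0) (𝐞 κ) x y (𝐞 ι') := by
  have h : ∀ κ v x y, blockAiota L κ 1 2 0 v x y = twoDD v * L.S (.eq 1) (.ge 0) (.ge 2) (.ge 0) (𝐞 κ) x y v :=
    fun κ v x y => by rw [blockAiota, ofBase_zero]; rfl
  rw [matAiota, matB_apply,
    iSup_eq_iSup_stepVec (fun v => ∑' x, ∑' y, ∑ κ, blockAiota L κ 1 2 0 v x y) fun v hv => by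
      simp [h, twoDD_of_not_exists hv]]
  simp only [h, twoDD_stepVec, one_mul]

/-- `(A^ι)_{2,0} = sup_v Σ_x Σ_κ T_{1̲,1,0}(e_κ,x,v)` (row `a = 2, b = 0 (⇒ x = y)`). [cite: FitznerVanDerHofstad2017, App. B Table "definition of A^{ι,a,b}(0,v,x,y)", row (2,0) (arXiv:1506.07977v2 p. 75); §5.1 (p. 49)] -/
theorem matAiota_two_zero : matAiota L 2 0 =
    ⨆ v, ∑' x, ∑ κ : Fin d × Bool, L.T (.eq 1) (.ge 1) (.ge 0) (𝐞 κ) x v := by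
  have h : ∀ κ v x y, blockAiota L κ 2 0 0 v x y = kd x y * L.T (.eq 1) (.ge 1) (.ge 0) (𝐞 κ) x v :=
    fun κ v x y => by rw [blockAiota, ofBase_zero]; rfl
  rw [matAiota, matB_apply]
  refine iSup_congr fun v => tsum_congr fun x => ?_
  rw [tsum_eq_single x fun y hy => by simp [h, kd_of_ne (Ne.symm hy)]]
  simp [h]

/-- `(A^ι)_{2,1} = sup_v Σ_{x,y} Σ_κ S_{1̲,0,1̲,0}(e_κ,x,y,v)`. [cite: FitznerVanDerHofstad2017, App. B Table "definition of A^{ι,a,b}(0,v,x,y)", row (2,1) (arXiv:1506.07977v2 p. 75); §5.1 (p. 49)] -/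
theorem matAiota_two_one : matAiota L 2 1 =
    ⨆ v, ∑' x, ∑' y, ∑ κ : Fin d × Bool, L.S (.eq 1) (.ge 0) (.eq 1) (.ge 0) (𝐞 κ) x y v := by
  have h : ∀ κ v x y, blockAiota L κ 2 1 0 v x y = L.S (.eq 1) (.ge 0) (.eq 1) (.ge 0) (𝐞 κ) x y v :=
    fun κ v x y => by rw [blockAiota, ofBase_zero]; rfl
  rw [matAiota, matB_apply]
  simp only [h]

/-- `(A^ι)_{2,2} = sup_v Σ_{x,y} Σ_κ S_{1̲,0,2,0}(e_κ,x,y,v)`. [cite: FitznerVanDerHofstad2017, App. B Table "definition of A^{ι,a,b}(0,v,x,y)", row (2,2) (arXiv:1506.07977v2 p. 75); §5.1 (p. 49)] -/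
theorem matAiota_two_two : matAiota L 2 2 =
    ⨆ v, ∑' x, ∑' y, ∑ κ : Fin d × Bool, L.S (.eq 1) (.ge 0) (.ge 2) (.ge 0) (𝐞 κ) x y v := by
  have h : ∀ κ v x y, blockAiota L κ 2 2 0 v x y = L.S (.eq 1) (.ge 0) (.ge 2) (.ge 0) (𝐞 κ) x y v :=
    fun κ v x y => by rw [blockAiota, ofBase_zero]; rfl
  rw [matAiota, matB_apply]
  simp only [h]

/-- `(A^{ι,*})_{1,0} = (A^ι)_{1,0}`'s form (row `b = 0` repulsive). [cite: FitznerVanDerHofstad2017, App. B, sentence after Table "A^{ι,a,b}" (arXiv:1506.07977v2 p. 75); §5.1 (p. 49)] -/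
theorem matAiotaSt_one_zero : matAiotaSt L 1 0 =
    ⨆ ι' : Fin d × Bool, ∑' x, ∑ κ : Fin d × Bool, kdc x 0 * L.T (.eq 1) (.ge 1) (.ge 0) (𝐞 κ) x (𝐞 ι') := by
  have h : ∀ κ v x y, blockAiotaSt L κ 1 0 0 v x y =
      kd x y * kdc x 0 * twoDD v * L.T (.eq 1) (.ge 1) (.ge 0) (𝐞 κ) x v := fun κ v x y => by
    rw [blockAiotaSt, ofBase_zero]; rfl
  rw [matAiotaSt, matB_apply,
    iSup_eq_iSup_stepVec (fun v => ∑' x, ∑' y, ∑ κ, blockAiotaSt L κ 1 0 0 v x y) fun v hv => by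
      simp [h, twoDD_of_not_exists hv]]
  refine iSup_congr fun ι' => tsum_congr fun x => ?_
  rw [tsum_eq_single x fun y hy => by simp [h, kd_of_ne (Ne.symm hy)]]
  simp [h, twoDD_stepVec]

/-- `(A^{ι,*})_{1,1} = sup_{ι'} Σ_{x,y} Σ_κ S^*_{1̲,0,1̲,0}(e_κ,x,y,e_{ι'})`. [cite: FitznerVanDerHofstad2017, App. B, sentence after Table "A^{ι,a,b}" (arXiv:1506.07977v2 p. 75); §5.1 (p. 49)] -/
theorem matAiotaSt_one_one : matAiotaSt L 1 1 =
    ⨆ ι' : Fin d × Bool, ∑' x, ∑' y, ∑ κ : Fin d × Bool, L.Sst (.eq 1) (.ge 0) (.eq 1) (.ge 0) (𝐞 κ) x y (𝐞 ι') := by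
  have h : ∀ κ v x y, blockAiotaSt L κ 1 1 0 v x y = twoDD v * L.Sst (.eq 1) (.ge 0) (.eq 1) (.ge 0) (𝐞 κ) x y v :=
    fun κ v x y => by rw [blockAiotaSt, ofBase_zero]; rfl
  rw [matAiotaSt, matB_apply,
    iSup_eq_iSup_stepVec (fun v => ∑' x, ∑' y, ∑ κ, blockAiotaSt L κ 1 1 0 v x y) fun v hv => by
      simp [h, twoDD_of_not_exists hv]]
  simp only [h, twoDD_stepVec, one_mul]

/-- `(A^{ι,*})_{1,2} = sup_{ι'} Σ_{x,y} Σ_κ S^*_{1̲,0,2,0}(e_κ,x,y,e_{ι'})`. [cite: FitznerVanDerHofstad2017, App. B, sentence after Table "A^{ι,a,b}" (arXiv:1506.07977v2 p. 75); §5.1 (p. 49)] -/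
theorem matAiotaSt_one_two : matAiotaSt L 1 2 =
    ⨆ ι' : Fin d × Bool, ∑' x, ∑' y, ∑ κ : Fin d × Bool, L.Sst (.eq 1) (.ge 0) (.ge 2) (.ge 0) (𝐞 κ) x y (𝐞 ι') := by
  have h : ∀ κ v x y, blockAiotaSt L κ 1 2 0 v x y = twoDD v * L.Sst (.eq 1) (.ge 0) (.ge 2) (.ge 0) (𝐞 κ) x y v :=
    fun κ v x y => by rw [blockAiotaSt, ofBase_zero]; rfl
  rw [matAiotaSt, matB_apply,
    iSup_eq_iSup_stepVec (fun v => ∑' x, ∑' y, ∑ κ, blockAiotaSt L κ 1 2 0 v x y) fun v hv => by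
      simp [h, twoDD_of_not_exists hv]]
  simp only [h, twoDD_stepVec, one_mul]

/-- `(A^{ι,*})_{2,0} = sup_v Σ_x Σ_κ T_{1̲,1,0}(e_κ,x,v)`. [cite: FitznerVanDerHofstad2017, App. B, sentence after Table "A^{ι,a,b}" (arXiv:1506.07977v2 p. 75); §5.1 (p. 49)] -/
theorem matAiotaSt_two_zero : matAiotaSt L 2 0 =
    ⨆ v, ∑' x, ∑ κ : Fin d × Bool, L.T (.eq 1) (.ge 1) (.ge 0) (𝐞 κ) x v := by
  have h : ∀ κ v x y, blockAiotaSt L κ 2 0 0 v x y = kd x y * L.T (.eq 1) (.ge 1) (.ge 0) (𝐞 κ) x v :=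
    fun κ v x y => by rw [blockAiotaSt, ofBase_zero]; rfl
  rw [matAiotaSt, matB_apply]
  refine iSup_congr fun v => tsum_congr fun x => ?_
  rw [tsum_eq_single x fun y hy => by simp [h, kd_of_ne (Ne.symm hy)]]
  simp [h]

/-- `(A^{ι,*})_{2,1} = sup_v Σ_{x,y} Σ_κ S^*_{1̲,0,1̲,0}(e_κ,x,y,v)`. [cite: FitznerVanDerHofstad2017, App. B, sentence after Table "A^{ι,a,b}" (arXiv:1506.07977v2 p. 75); §5.1 (p. 49)] -/
theorem matAiotaSt_two_one : matAiotaSt L 2 1 =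
    ⨆ v, ∑' x, ∑' y, ∑ κ : Fin d × Bool, L.Sst (.eq 1) (.ge 0) (.eq 1) (.ge 0) (𝐞 κ) x y v := by
  have h : ∀ κ v x y, blockAiotaSt L κ 2 1 0 v x y = L.Sst (.eq 1) (.ge 0) (.eq 1) (.ge 0) (𝐞 κ) x y v :=
    fun κ v x y => by rw [blockAiotaSt, ofBase_zero]; rfl
  rw [matAiotaSt, matB_apply]
  simp only [h]

/-- `(A^{ι,*})_{2,2} = sup_v Σ_{x,y} Σ_κ S^*_{1̲,0,2,0}(e_κ,x,y,v)`. [cite: FitznerVanDerHofstad2017, App. B, sentence after Table "A^{ι,a,b}" (arXiv:1506.07977v2 p. 75); §5.1 (p. 49)] -/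
theorem matAiotaSt_two_two : matAiotaSt L 2 2 =
    ⨆ v, ∑' x, ∑' y, ∑ κ : Fin d × Bool, L.Sst (.eq 1) (.ge 0) (.ge 2) (.ge 0) (𝐞 κ) x y v := by
  have h : ∀ κ v x y, blockAiotaSt L κ 2 2 0 v x y = L.Sst (.eq 1) (.ge 0) (.ge 2) (.ge 0) (𝐞 κ) x y v :=
    fun κ v x y => by rw [blockAiotaSt, ofBase_zero]; rfl
  rw [matAiotaSt, matB_apply]
  simp only [h]

/-! ## Rows `a = 1`, `a = 2` of `Ā^ι`, `Ā^{ι,*}` -/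

/-- `(Ā^ι)_{1,0} = sup_{ι'} Σ_x Σ_κ (1−δ_{x,0}) T_{1̲,1,0}(e_κ,x,e_{ι'})` — the supremum over the out-gap `y` is
attained at `y = 0` (`δ_{x,y}`), the one over `v` restricts to the unit vectors (`2dD(v)`); `Ā^{ι,1,0} = A^{ι,1,0}`.
[cite: FitznerVanDerHofstad2017, App. B Tables "A^{ι,a,b}" row (1,0) and "Ā^{ι,a,b}" (arXiv:1506.07977v2 pp. 75, 78); §5.1 (p. 49); (6.5) (p. 58)] -/
theorem matAbarIota_one_zero : matAbarIota L 1 0 =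
    ⨆ ι' : Fin d × Bool, ∑' x, ∑ κ : Fin d × Bool, kdc x 0 * L.T (.eq 1) (.ge 1) (.ge 0) (𝐞 κ) x (𝐞 ι') := by
  have h : ∀ κ v x y, blockAbar L κ 1 0 0 v x y =
      kd x y * kdc x 0 * twoDD v * L.T (.eq 1) (.ge 1) (.ge 0) (𝐞 κ) x v := fun κ v x y => by
    rw [blockAbar, ofBase_zero]; rfl
  rw [matAbarIota, matAbar_apply,
    iSup_eq_iSup_stepVec (fun v => ⨆ y, ∑' x, ∑ κ, blockAbar L κ 1 0 0 v x (x + y)) fun v hv => by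
      simp [h, twoDD_of_not_exists hv]]
  refine iSup_congr fun ι' => ?_
  rw [iSup_eq_apply_zero (fun y => ∑' x, ∑ κ, blockAbar L κ 1 0 0 (𝐞 ι') x (x + y)) fun y hy => by
      have hx : ∀ x : Site d, kd x (x + y) = 0 := fun x => kd_of_ne fun e => hy (by simpa using e.symm)
      simp [h, hx]]
  simp [h, twoDD_stepVec]

/-- `(Ā^ι)_{1,1} = sup_{ι'} sup_y Σ_x Σ_κ p⁻¹ S_{1̲,0,1̲,0}(e_κ,x,x+y,e_{ι'})` (`Ā^{ι,1,1} = p⁻¹ A^{ι,1,1}`; both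
suprema survive, the one over `v` restricted to the unit vectors). [cite: FitznerVanDerHofstad2017, App. B Tables "A^{ι,a,b}" row (1,1) and "Ā^{ι,a,b}" (arXiv:1506.07977v2 pp. 75, 78); §5.1 (p. 49); (6.5) (p. 58)] -/
theorem matAbarIota_one_one : matAbarIota L 1 1 =
    ⨆ ι' : Fin d × Bool, ⨆ y, ∑' x, ∑ κ : Fin d × Bool,
      L.p⁻¹ * L.S (.eq 1) (.ge 0) (.eq 1) (.ge 0) (𝐞 κ) x (x + y) (𝐞 ι') := by
  have h : ∀ κ v x y, blockAbar L κ 1 1 0 v x y =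
      L.p⁻¹ * (twoDD v * L.S (.eq 1) (.ge 0) (.eq 1) (.ge 0) (𝐞 κ) x y v) := fun κ v x y => by
    rw [blockAbar, ofBase_zero]; rfl
  rw [matAbarIota, matAbar_apply,
    iSup_eq_iSup_stepVec (fun v => ⨆ y, ∑' x, ∑ κ, blockAbar L κ 1 1 0 v x (x + y)) fun v hv => by
      simp [h, twoDD_of_not_exists hv]]
  simp only [h, twoDD_stepVec, one_mul]

/-- `(Ā^ι)_{1,2} = sup_{ι'} sup_y Σ_x Σ_κ p⁻¹ S^*_{0,1̲,1̲,0}(e_{ι'}−(x+y), −(x+y), e_κ−(x+y), −y)` (row `a = 1,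
b = 2`: `p⁻¹ S^*_{0,1̲,1̲,0}(v−y,−y,e−y,x−y)` at `(0,v,x,x+y)`, `v = e_{ι'}` by `2dD(v)` — see the module docstring
of `NobleBlocks` for the reading of this row). [cite: FitznerVanDerHofstad2017, App. B Table "definition of Ā^{ι,a,b}(0,v,x,y)", row (1,2) (arXiv:1506.07977v2 p. 78); §5.1 (p. 49); (6.5) (p. 58)] -/
theorem matAbarIota_one_two : matAbarIota L 1 2 =
    ⨆ v, ⨆ y, ∑' x, ∑ κ : Fin d × Bool,
      L.p⁻¹ * L.Sst (.ge 0) (.eq 1) (.eq 1) (.ge 0) (v - (x + y)) (-(x + y)) (𝐞 κ - (x + y)) (-y) := by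
  have h : ∀ κ v x y, blockAbar L κ 1 2 0 v x y =
      L.p⁻¹ * L.Sst (.ge 0) (.eq 1) (.eq 1) (.ge 0) (v - y) (-y) (𝐞 κ - y) (x - y) := fun κ v x y => by
    rw [blockAbar, ofBase_zero]; rfl
  rw [matAbarIota, matAbar_apply]
  simp only [h, sub_add_cancel_left]

/-- `(Ā^ι)_{2,0} = sup_v Σ_x Σ_κ T_{1̲,1,0}(e_κ,x,v)` (the out-gap supremum is attained at `y = 0`).
[cite: FitznerVanDerHofstad2017, App. B Tables "A^{ι,a,b}" row (2,0) and "Ā^{ι,a,b}" (arXiv:1506.07977v2 pp. 75, 78); §5.1 (p. 49); (6.5) (p. 58)] -/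
theorem matAbarIota_two_zero : matAbarIota L 2 0 =
    ⨆ v, ∑' x, ∑ κ : Fin d × Bool, L.T (.eq 1) (.ge 1) (.ge 0) (𝐞 κ) x v := by
  have h : ∀ κ v x y, blockAbar L κ 2 0 0 v x y = kd x y * L.T (.eq 1) (.ge 1) (.ge 0) (𝐞 κ) x v :=
    fun κ v x y => by rw [blockAbar, ofBase_zero]; rfl
  rw [matAbarIota, matAbar_apply]
  refine iSup_congr fun v => ?_
  rw [iSup_eq_apply_zero (fun y => ∑' x, ∑ κ, blockAbar L κ 2 0 0 v x (x + y)) fun y hy => by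
      have hx : ∀ x : Site d, kd x (x + y) = 0 := fun x => kd_of_ne fun e => hy (by simpa using e.symm)
      simp [h, hx]]
  simp [h]

/-- `(Ā^ι)_{2,1} = sup_v sup_y Σ_x Σ_κ p⁻¹ S_{1̲,0,1̲,0}(e_κ,x,x+y,v)`. [cite: FitznerVanDerHofstad2017, App. B Tables "A^{ι,a,b}" row (2,1) and "Ā^{ι,a,b}" (arXiv:1506.07977v2 pp. 75, 78); §5.1 (p. 49); (6.5) (p. 58)] -/
theorem matAbarIota_two_one : matAbarIota L 2 1 =
    ⨆ v, ⨆ y, ∑' x, ∑ κ : Fin d × Bool, L.p⁻¹ * L.S (.eq 1) (.ge 0) (.eq 1) (.ge 0) (𝐞 κ) x (x + y) v := by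
  have h : ∀ κ v x y, blockAbar L κ 2 1 0 v x y = L.p⁻¹ * L.S (.eq 1) (.ge 0) (.eq 1) (.ge 0) (𝐞 κ) x y v :=
    fun κ v x y => by rw [blockAbar, ofBase_zero]; rfl
  rw [matAbarIota, matAbar_apply]
  simp only [h]

/-- `(Ā^ι)_{2,2} = sup_w Σ_x Σ_κ p τ(x−e_κ) τ(w−x)` (row `a, b ≥ 2`: `p τ(x−e) τ(v−y)` at `(0,v,x,x+y)`; the two
suprema over `v` and the out-gap `y` merge into one over `w = v − y`). [cite: FitznerVanDerHofstad2017, App. B Table "definition of Ā^{ι,a,b}(0,v,x,y)", row (2,2) (arXiv:1506.07977v2 p. 78); §5.1 (p. 49); (6.5) (p. 58)] -/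
theorem matAbarIota_two_two : matAbarIota L 2 2 =
    ⨆ w, ∑' x, ∑ κ : Fin d × Bool, L.p * L.tau (.ge 0) (x - 𝐞 κ) * L.tau (.ge 0) (w - x) := by
  have h : ∀ κ v x y, blockAbar L κ 2 2 0 v x y = L.p * L.tau (.ge 0) (x - 𝐞 κ) * L.tau (.ge 0) (v - y) :=
    fun κ v x y => by rw [blockAbar, ofBase_zero]; rfl
  have hs : ∀ v x y : Site d, v - (x + y) = v - y - x := fun v x y => by abel
  rw [matAbarIota, matAbar_apply]
  simp only [h, hs]
  exact iSup_iSup_sub_eq fun w => ∑' x, ∑ κ : Fin d × Bool, L.p * L.tau (.ge 0) (x - 𝐞 κ) * L.tau (.ge 0) (w - x)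

/-- `(Ā^{ι,*})_{1,0} = (Ā^ι)_{1,0}`'s form (row `b = 0` repulsive). [cite: FitznerVanDerHofstad2017, §5.1 Table "Ā^{ι,a,b,*}" (arXiv:1506.07977v2 p. 47); App. B (pp. 75, 78)] -/
theorem matAbarIotaSt_one_zero : matAbarIotaSt L 1 0 =
    ⨆ ι' : Fin d × Bool, ∑' x, ∑ κ : Fin d × Bool, kdc x 0 * L.T (.eq 1) (.ge 1) (.ge 0) (𝐞 κ) x (𝐞 ι') := by
  have h : ∀ κ v x y, blockAbarSt L κ 1 0 0 v x y =
      kd x y * kdc x 0 * twoDD v * L.T (.eq 1) (.ge 1) (.ge 0) (𝐞 κ) x v := fun κ v x y => by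
    rw [blockAbarSt, ofBase_zero]; rfl
  rw [matAbarIotaSt, matAbar_apply,
    iSup_eq_iSup_stepVec (fun v => ⨆ y, ∑' x, ∑ κ, blockAbarSt L κ 1 0 0 v x (x + y)) fun v hv => by
      simp [h, twoDD_of_not_exists hv]]
  refine iSup_congr fun ι' => ?_
  rw [iSup_eq_apply_zero (fun y => ∑' x, ∑ κ, blockAbarSt L κ 1 0 0 (𝐞 ι') x (x + y)) fun y hy => by
      have hx : ∀ x : Site d, kd x (x + y) = 0 := fun x => kd_of_ne fun e => hy (by simpa using e.symm)
      simp [h, hx]]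
  simp [h, twoDD_stepVec]

/-- `(Ā^{ι,*})_{1,1} = sup_{ι'} sup_y Σ_x Σ_κ p⁻¹ S^*_{1̲,0,1̲,0}(e_κ,x,x+y,e_{ι'})` (`Ā^{ι,1,1,*} = p⁻¹ A^{ι,1,1,*}`).
[cite: FitznerVanDerHofstad2017, §5.1 Table "Ā^{ι,a,b,*}" (arXiv:1506.07977v2 p. 47); App. B (pp. 75, 78); (6.5) (p. 58)] -/
theorem matAbarIotaSt_one_one : matAbarIotaSt L 1 1 =
    ⨆ ι' : Fin d × Bool, ⨆ y, ∑' x, ∑ κ : Fin d × Bool,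
      L.p⁻¹ * L.Sst (.eq 1) (.ge 0) (.eq 1) (.ge 0) (𝐞 κ) x (x + y) (𝐞 ι') := by
  have h : ∀ κ v x y, blockAbarSt L κ 1 1 0 v x y =
      L.p⁻¹ * (twoDD v * L.Sst (.eq 1) (.ge 0) (.eq 1) (.ge 0) (𝐞 κ) x y v) := fun κ v x y => by
    rw [blockAbarSt, ofBase_zero]; rfl
  rw [matAbarIotaSt, matAbar_apply,
    iSup_eq_iSup_stepVec (fun v => ⨆ y, ∑' x, ∑ κ, blockAbarSt L κ 1 1 0 v x (x + y)) fun v hv => by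
      simp [h, twoDD_of_not_exists hv]]
  simp only [h, twoDD_stepVec, one_mul]

/-- `(Ā^{ι,*})_{1,2} = (Ā^ι)_{1,2}`'s form (row `b ≥ 2` already non-repulsive).
[cite: FitznerVanDerHofstad2017, §5.1 Table "Ā^{ι,a,b,*}" (arXiv:1506.07977v2 p. 47); App. B (p. 78); (6.5) (p. 58)] -/
theorem matAbarIotaSt_one_two : matAbarIotaSt L 1 2 =
    ⨆ v, ⨆ y, ∑' x, ∑ κ : Fin d × Bool,
      L.p⁻¹ * L.Sst (.ge 0) (.eq 1) (.eq 1) (.ge 0) (v - (x + y)) (-(x + y)) (𝐞 κ - (x + y)) (-y) := by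
  have h : ∀ κ v x y, blockAbarSt L κ 1 2 0 v x y =
      L.p⁻¹ * L.Sst (.ge 0) (.eq 1) (.eq 1) (.ge 0) (v - y) (-y) (𝐞 κ - y) (x - y) := fun κ v x y => by
    rw [blockAbarSt, ofBase_zero]; rfl
  rw [matAbarIotaSt, matAbar_apply]
  simp only [h, sub_add_cancel_left]

/-- `(Ā^{ι,*})_{2,0} = sup_v Σ_x Σ_κ T_{1̲,1,0}(e_κ,x,v)`. [cite: FitznerVanDerHofstad2017, §5.1 Table "Ā^{ι,a,b,*}" (arXiv:1506.07977v2 p. 47); App. B (pp. 75, 78); (6.5) (p. 58)] -/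
theorem matAbarIotaSt_two_zero : matAbarIotaSt L 2 0 =
    ⨆ v, ∑' x, ∑ κ : Fin d × Bool, L.T (.eq 1) (.ge 1) (.ge 0) (𝐞 κ) x v := by
  have h : ∀ κ v x y, blockAbarSt L κ 2 0 0 v x y = kd x y * L.T (.eq 1) (.ge 1) (.ge 0) (𝐞 κ) x v :=
    fun κ v x y => by rw [blockAbarSt, ofBase_zero]; rfl
  rw [matAbarIotaSt, matAbar_apply]
  refine iSup_congr fun v => ?_
  rw [iSup_eq_apply_zero (fun y => ∑' x, ∑ κ, blockAbarSt L κ 2 0 0 v x (x + y)) fun y hy => by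
      have hx : ∀ x : Site d, kd x (x + y) = 0 := fun x => kd_of_ne fun e => hy (by simpa using e.symm)
      simp [h, hx]]
  simp [h]

/-- `(Ā^{ι,*})_{2,1} = sup_v sup_y Σ_x Σ_κ p⁻¹ S^*_{1̲,0,1̲,0}(e_κ,x,x+y,v)`. [cite: FitznerVanDerHofstad2017, §5.1 Table "Ā^{ι,a,b,*}" (arXiv:1506.07977v2 p. 47); App. B (pp. 75, 78); (6.5) (p. 58)] -/
theorem matAbarIotaSt_two_one : matAbarIotaSt L 2 1 =
    ⨆ v, ⨆ y, ∑' x, ∑ κ : Fin d × Bool, L.p⁻¹ * L.Sst (.eq 1) (.ge 0) (.eq 1) (.ge 0) (𝐞 κ) x (x + y) v := by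
  have h : ∀ κ v x y, blockAbarSt L κ 2 1 0 v x y =
      L.p⁻¹ * L.Sst (.eq 1) (.ge 0) (.eq 1) (.ge 0) (𝐞 κ) x y v := fun κ v x y => by
    rw [blockAbarSt, ofBase_zero]; rfl
  rw [matAbarIotaSt, matAbar_apply]
  simp only [h]

/-- `(Ā^{ι,*})_{2,2} = sup_w Σ_x Σ_κ p τ(x−e_κ) τ(w−x)`. [cite: FitznerVanDerHofstad2017, §5.1 Table "Ā^{ι,a,b,*}" (arXiv:1506.07977v2 p. 47); App. B (p. 78); (6.5) (p. 58)] -/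
theorem matAbarIotaSt_two_two : matAbarIotaSt L 2 2 =
    ⨆ w, ∑' x, ∑ κ : Fin d × Bool, L.p * L.tau (.ge 0) (x - 𝐞 κ) * L.tau (.ge 0) (w - x) := by
  have h : ∀ κ v x y, blockAbarSt L κ 2 2 0 v x y = L.p * L.tau (.ge 0) (x - 𝐞 κ) * L.tau (.ge 0) (v - y) :=
    fun κ v x y => by rw [blockAbarSt, ofBase_zero]; rfl
  have hs : ∀ v x y : Site d, v - (x + y) = v - y - x := fun v x y => by abel
  rw [matAbarIotaSt, matAbar_apply]
  simp only [h, hs]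
  exact iSup_iSup_sub_eq fun w => ∑' x, ∑ κ : Fin d × Bool, L.p * L.tau (.ge 0) (x - 𝐞 κ) * L.tau (.ge 0) (w - x)

end Rows

/-! ## V. The vectors `Σ_ι P^{ι,1}`, `Σ_ι P^{ι,2}`, `(P⃗^ι)_1`, `(P⃗^ι)_2` -/

section Vectors

variable (L : Letters d)

/-- `Σ_y δ_{y,x} = 1`. [folklore] -/
theorem tsum_kd_left (x : Site d) : ∑' y, kd y x = 1 := by
  rw [tsum_eq_single x fun y hy => kd_of_ne hy]
  simp

/-- `1 − δ_{x,e} = 1 − δ_{x−e,0}`. [folklore] -/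
theorem kdc_eq_kdc_sub_zero (x e : Site d) : kdc x e = kdc (x - e) 0 := by
  simp [kdc, sub_eq_zero]

/-- `Σ_{x,y} P^{ι,1}(x,y) = τ_3(e_ι)[Σ_x B_{3,1̲}(x,0) + Σ_{x,y} T_{1,1̲,1}(y,x,0)] + Σ_y B_{2,1̲}(y,e_ι)` (row `b = 1`:
`τ_3(e)(δ_{e,y} B_{3,1̲}(x−e,0) + T_{1,1̲,1}(y−e,x−e,0)) + δ_{x,e} B_{2,1̲}(y,e)`, shifts by `e` summed out).
[cite: FitznerVanDerHofstad2017, App. B Table "definition of P^{ι,b}(x,y)", row b = 1 (arXiv:1506.07977v2 p. 73); §5.1 "Elements of the bounds" (p. 50)] -/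
theorem pairSum_blockPiota_one (ι : Fin d × Bool) :
    ∑' x, ∑' y, blockPiota L ι 1 x y =
      L.tau (.ge 3) (𝐞 ι) * ((∑' x, L.B (.ge 3) (.eq 1) x 0) + ∑' x, ∑' y, L.T (.ge 1) (.eq 1) (.ge 1) y x 0) +
        ∑' y, L.B (.ge 2) (.eq 1) y (𝐞 ι) := by
  have h : ∀ x y, blockPiota L ι 1 x y = L.tau (.ge 3) (𝐞 ι) *
      (kd y (𝐞 ι) * L.B (.ge 3) (.eq 1) (x - 𝐞 ι) 0 + L.T (.ge 1) (.eq 1) (.ge 1) (y - 𝐞 ι) (x - 𝐞 ι) 0) +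
        kd x (𝐞 ι) * L.B (.ge 2) (.eq 1) y (𝐞 ι) := fun _ _ => rfl
  have h1 : ∑' x, L.B (.ge 3) (.eq 1) (x - 𝐞 ι) 0 = ∑' x, L.B (.ge 3) (.eq 1) x 0 :=
    tsum_sub_right_eq (fun z => L.B (.ge 3) (.eq 1) z 0) (𝐞 ι)
  have h2 : ∑' x, ∑' y, L.T (.ge 1) (.eq 1) (.ge 1) (y - 𝐞 ι) (x - 𝐞 ι) 0 =
      ∑' x, ∑' y, L.T (.ge 1) (.eq 1) (.ge 1) y x 0 := by
    rw [show (∑' x, ∑' y, L.T (.ge 1) (.eq 1) (.ge 1) (y - 𝐞 ι) (x - 𝐞 ι) 0) =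
        ∑' x, ∑' y, L.T (.ge 1) (.eq 1) (.ge 1) y (x - 𝐞 ι) 0 from
      tsum_congr fun x => tsum_sub_right_eq (fun z => L.T (.ge 1) (.eq 1) (.ge 1) z (x - 𝐞 ι) 0) (𝐞 ι)]
    exact tsum_sub_right_eq (fun z => ∑' y, L.T (.ge 1) (.eq 1) (.ge 1) y z 0) (𝐞 ι)
  simp only [h, ENNReal.tsum_add, ENNReal.tsum_mul_left, ENNReal.tsum_mul_right, tsum_kd_left, one_mul, h1, h2]

/-- `Σ_{ι,x,y} P^{ι,1}(x,y)` in letters. [cite: FitznerVanDerHofstad2017, App. B Table "definition of P^{ι,b}(x,y)", row b = 1 (arXiv:1506.07977v2 p. 73); §5.1 "Elements of the bounds" (p. 50)] -/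
theorem vecPiotaSum_one : vecPiotaSum L 1 = ∑ ι : Fin d × Bool,
    (L.tau (.ge 3) (𝐞 ι) * ((∑' x, L.B (.ge 3) (.eq 1) x 0) + ∑' x, ∑' y, L.T (.ge 1) (.eq 1) (.ge 1) y x 0) +
      ∑' y, L.B (.ge 2) (.eq 1) y (𝐞 ι)) := by
  show ∑' x, ∑' y, ∑ ι : Fin d × Bool, blockPiota L ι 1 x y = _
  simp only [tsum_finsetSum, pairSum_blockPiota_one]

/-- `(P⃗^ι)_1 = (1/2d) Σ_{ι,x,y} P^{ι,1}(x,y)` in letters. [cite: FitznerVanDerHofstad2017, §5.1 "Elements of the bounds", P⃗^ι (arXiv:1506.07977v2 p. 50)] -/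
theorem vecPiota_one : vecPiota L 1 = invTwoD d * ∑ ι : Fin d × Bool,
    (L.tau (.ge 3) (𝐞 ι) * ((∑' x, L.B (.ge 3) (.eq 1) x 0) + ∑' x, ∑' y, L.T (.ge 1) (.eq 1) (.ge 1) y x 0) +
      ∑' y, L.B (.ge 2) (.eq 1) y (𝐞 ι)) := by
  show invTwoD d * ((if (1 : Fin 3) = 0 then 1 else 0) + vecPiotaSum L 1) = _
  rw [if_neg (by decide), zero_add, vecPiotaSum_one]

/-- `Σ_{x,y} P^{ι,2}(x,y) = τ_3(e_ι) (P⃗^S)_2 + [τ_3(e_ι) + Σ_y B_{1,2}(y,e_ι)] + [Σ_x (1−δ_{x,0}) P̃(0⇔x)]·[Σ_y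
B_{1,1}(y,e_ι) + τ_3(e_ι)]` (row `b = 2`: the three summands "y on the sausage" `τ_3(e) P^{S,2}(x−e,y−e)`, "x = e"
`δ_{0,y} τ_3(e) + B_{1,2}(y,x)`, "x ≠ e" `(B_{1,1}(y,e) + δ_{0,y} τ_3(e))(1−δ_{e,x}) P̃(e⇔x)`).
[cite: FitznerVanDerHofstad2017, App. B Table "definition of P^{ι,b}(x,y)", row b = 2 (arXiv:1506.07977v2 p. 73); §5.1 "Elements of the bounds" (p. 50)] -/
theorem pairSum_blockPiota_two (ι : Fin d × Bool) :
    ∑' x, ∑' y, blockPiota L ι 2 x y =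
      L.tau (.ge 3) (𝐞 ι) * vecPS L 2 + (L.tau (.ge 3) (𝐞 ι) + ∑' y, L.B (.ge 1) (.ge 2) y (𝐞 ι)) +
        (∑' x, kdc x 0 * L.pdbc x) * ((∑' y, L.B (.ge 1) (.ge 1) y (𝐞 ι)) + L.tau (.ge 3) (𝐞 ι)) := by
  have h : ∀ x y, blockPiota L ι 2 x y = L.tau (.ge 3) (𝐞 ι) * blockPS L 2 (x - 𝐞 ι) (y - 𝐞 ι) +
      kd x (𝐞 ι) * (kd y 0 * L.tau (.ge 3) (𝐞 ι) + L.B (.ge 1) (.ge 2) y x) +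
      kdc x (𝐞 ι) * ((L.B (.ge 1) (.ge 1) y (𝐞 ι) + kd y 0 * L.tau (.ge 3) (𝐞 ι)) * L.pdbc (x - 𝐞 ι)) :=
    fun _ _ => rfl
  have h' : ∀ x y, blockPiota L ι 2 x y = L.tau (.ge 3) (𝐞 ι) * blockPS L 2 (x - 𝐞 ι) (y - 𝐞 ι) +
      kd x (𝐞 ι) * (kd y 0 * L.tau (.ge 3) (𝐞 ι)) + kd x (𝐞 ι) * L.B (.ge 1) (.ge 2) y x +
      (kdc (x - 𝐞 ι) 0 * L.pdbc (x - 𝐞 ι)) * L.B (.ge 1) (.ge 1) y (𝐞 ι) +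
      (kdc (x - 𝐞 ι) 0 * L.pdbc (x - 𝐞 ι)) * (kd y 0 * L.tau (.ge 3) (𝐞 ι)) := fun x y => by
    rw [h, kdc_eq_kdc_sub_zero x (𝐞 ι)]; ring
  have h1 : ∑' x, ∑' y, blockPS L 2 (x - 𝐞 ι) (y - 𝐞 ι) = vecPS L 2 := by
    rw [show (∑' x, ∑' y, blockPS L 2 (x - 𝐞 ι) (y - 𝐞 ι)) = ∑' x, ∑' y, blockPS L 2 (x - 𝐞 ι) y from
      tsum_congr fun x => tsum_sub_right_eq (fun z => blockPS L 2 (x - 𝐞 ι) z) (𝐞 ι)]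
    exact tsum_sub_right_eq (fun z => ∑' y, blockPS L 2 z y) (𝐞 ι)
  have h2 : ∑' x, kdc (x - 𝐞 ι) 0 * L.pdbc (x - 𝐞 ι) = ∑' x, kdc x 0 * L.pdbc x :=
    tsum_sub_right_eq (fun z => kdc z 0 * L.pdbc z) (𝐞 ι)
  simp only [h', ENNReal.tsum_add, ENNReal.tsum_mul_left, ENNReal.tsum_mul_right, tsum_kd_mul, tsum_kd_left,
    one_mul, h1, h2]
  ring

/-- `Σ_{ι,x,y} P^{ι,2}(x,y)` in letters. [cite: FitznerVanDerHofstad2017, App. B Table "definition of P^{ι,b}(x,y)", row b = 2 (arXiv:1506.07977v2 p. 73); §5.1 "Elements of the bounds" (p. 50)] -/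
theorem vecPiotaSum_two : vecPiotaSum L 2 = ∑ ι : Fin d × Bool,
    (L.tau (.ge 3) (𝐞 ι) * vecPS L 2 + (L.tau (.ge 3) (𝐞 ι) + ∑' y, L.B (.ge 1) (.ge 2) y (𝐞 ι)) +
      (∑' x, kdc x 0 * L.pdbc x) * ((∑' y, L.B (.ge 1) (.ge 1) y (𝐞 ι)) + L.tau (.ge 3) (𝐞 ι))) := by
  show ∑' x, ∑' y, ∑ ι : Fin d × Bool, blockPiota L ι 2 x y = _
  simp only [tsum_finsetSum, pairSum_blockPiota_two]

/-- `(P⃗^ι)_2 = (1/2d) Σ_{ι,x,y} P^{ι,2}(x,y)` in letters. [cite: FitznerVanDerHofstad2017, §5.1 "Elements of the bounds", P⃗^ι (arXiv:1506.07977v2 p. 50)] -/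
theorem vecPiota_two : vecPiota L 2 = invTwoD d * ∑ ι : Fin d × Bool,
    (L.tau (.ge 3) (𝐞 ι) * vecPS L 2 + (L.tau (.ge 3) (𝐞 ι) + ∑' y, L.B (.ge 1) (.ge 2) y (𝐞 ι)) +
      (∑' x, kdc x 0 * L.pdbc x) * ((∑' y, L.B (.ge 1) (.ge 1) y (𝐞 ι)) + L.tau (.ge 3) (𝐞 ι))) := by
  show invTwoD d * ((if (2 : Fin 3) = 0 then 1 else 0) + vecPiotaSum L 2) = _
  rw [if_neg (by decide), zero_add, vecPiotaSum_two]

end Vectors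

end Literature.Probability.FitznerVanDerHofstad2017.NobleBlocks

end
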